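import Mathlib
import Literature.Probability.LatticeModels.TriangularLattice
import Literature.Probability.Percolation.TriHexagon
import Literature.Analysis.FunctionSpaces.PoissonPointProcess
import Literature.Analysis.FunctionSpaces.PoissonPointProcessUniqueness
import Summits.CriticalPhenomena.CardyFormulaZ2.Theorems.CardyFlipRussoQuadrupoleSelectionRuleGaussianRotation
import Summits.CriticalPhenomena.CardyFormulaZ2.Theorems.CardyFlipRussoQuadrupoleSelectionRulePartialReindex
import Summits.CriticalPhenomena.CardyFormulaZ2.Theorems.CardyFlipRussoQuadrupoleSelectionRuleHexRotGeometry
import Summits.CriticalPhenomena.CardyFormulaZ2.Theorems.CardyFlipRussoQuadrupoleSelectionRulePoissonPartialRotation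
import Summits.CriticalPhenomena.CardyFormulaZ2.Theorems.CardyFlipRussoQuadrupoleSelectionRuleBootstrap
import Summits.CriticalPhenomena.CardyFormulaZ2.Theorems.CardyFlipRussoQuadrupoleSelectionRuleCocircSimilarity
import Summits.CriticalPhenomena.CardyFormulaZ2.Theorems.CardyFlipRussoQuadrupoleSelectionRuleSpinTwo
import Summits.CriticalPhenomena.CardyFormulaZ2.Theorems.CardyFlipRussoQuadrupoleSelectionRuleSlotShift
import Summits.CriticalPhenomena.CardyFormulaZ2.Theorems.CardyFlipRussoQuadrupoleSelectionRuleAverageFirst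
import Summits.CriticalPhenomena.CardyFormulaZ2.Theorems.CardyFlipRussoQuadrupoleSelectionRuleInvolution
import Summits.CriticalPhenomena.CardyFormulaZ2.Theorems.CardyFlipRussoQuadrupoleSelectionRuleIsoCancel
import Summits.CriticalPhenomena.CardyFormulaZ2.Theorems.CardyFlipRussoQuadrupoleSelectionRuleExponents
import Summits.CriticalPhenomena.CardyFormulaZ2.Theorems.CardyFlipRussoQuadrupoleSelectionRuleLegMVT
import Summits.CriticalPhenomena.CardyFormulaZ2.Theorems.CardyFlipRussoQuadrupoleSelectionRuleLegMVTRight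
import Summits.CriticalPhenomena.CardyFormulaZ2.Theorems.CardyFlipRussoQuadrupoleSelectionRuleBitsLegTransfer
import Summits.CriticalPhenomena.CardyFormulaZ2.Theorems.CardyFlipRussoQuadrupoleSelectionRuleSiteGlue
import Summits.CriticalPhenomena.CardyFormulaZ2.Theorems.CardyFlipRussoQuadrupoleSelectionRulePoissonPerturbationAt
import Summits.CriticalPhenomena.CardyFormulaZ2.Theorems.CardyFlipRussoQuadrupoleSelectionRulePoissonLegContinuity
import Summits.CriticalPhenomena.CardyFormulaZ2.Theorems.CardyFlipRussoQuadrupoleSelectionRuleGaussianDilation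
import Summits.CriticalPhenomena.CardyFormulaZ2.Theorems.CardyFlipRussoQuadrupoleSelectionRuleCoordinateInfluence
import Summits.CriticalPhenomena.CardyFormulaZ2.Theorems.CardyFlipRussoQuadrupoleSelectionRuleJitterRusso
import Summits.CriticalPhenomena.CardyFormulaZ2.Theorems.CardyFlipRussoQuadrupoleSelectionRuleFlipArms
import Summits.CriticalPhenomena.CardyFormulaZ2.Theorems.CardyFlipRussoQuadrupoleSelectionRuleFlipLocalisation
import Summits.CriticalPhenomena.CardyFormulaZ2.Theorems.CardyFlipRussoQuadrupoleSelectionRuleDefs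
import Summits.CriticalPhenomena.CardyFormulaZ2.Theorems.CardyFlipRussoQuadrupoleSelectionRuleBitsReduction
import Summits.CriticalPhenomena.CardyFormulaZ2.Theorems.CardyFlipRussoQuadrupoleSelectionRuleEndpoint
import Summits.CriticalPhenomena.CardyFormulaZ2.Theorems.CardyFlipRussoQuadrupoleSelectionRuleMonotone
import Summits.CriticalPhenomena.CardyFormulaZ2.Theorems.CardyFlipRussoQuadrupoleSelectionRuleBulkLayer
import Summits.CriticalPhenomena.CardyFormulaZ2.Theorems.CardyFlipRussoQuadrupoleSelectionRuleGsTransfer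

/-!
# Skeleton of line `Sketch` for the crux `QuadrupoleSelectionRule` (stmt-CriticalPhenomena-7029)

Lead prover's skeleton (route `CardyFlipRusso`, sub-problem `CardyFormulaZ2`).  The crux item is
INFORMAL (no Lean declaration in `Theses/CardyFlipRusso.lean` yet, payload `crux.signature = null`),
so no skeleton can conclude it by name.  The line `Sketch` (planner's crux-ideate round 1,
`Cruxes/QuadrupoleSelectionRule/SketchIdeasR1K1.lean`) consists of the FIRST LEMMAS of the three
crux idea cards, stated as `def … : Prop`:

* Card A `average-first-odd-sector-gap`: `PartialRotationInvariance`, `PartialRotationGeometry`,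
  `PoissonPartialRotationInvariance` — the exact partial-rotation symmetry Φ_{z,r} of the leg laws;
* Card B `leg-continuity-robust-gap`: `BootstrapPrinciple`, `RobustBlockDecay`;
* Card C `poisson-hub-ward-identity`: `CocircSimilarityCovariance`, `CocircStrainSpinTwo`.

This skeleton keeps those statements VERBATIM and reduces all seven to seven def-free registered
stubs `stub_*` (general, Mathlib-style statements that land as `--supports` helper files under
`Theorems/CardyFlipRussoQuadrupoleSelectionRule<Stub>.lean`), plus the glue proving each card
statement from the stubs; the composition `firstLemmas` is the conjunction of the seven card
statements (the deliverable of this line while the crux is untyped).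

STATUS (cycle 1, 2026-08-16): CLOSED — all seven stubs are LANDED theorems of the tree, imported
below (S1 GaussianRotation p101881, S2 PartialReindex p101820, S3 HexRotGeometry p103281,
S4 PoissonPartialRotation p103301, S5 Bootstrap p101863, S6 CocircSimilarity p103287, S7 SpinTwo
p103285); this file has no `sorry`, and the audit shows the seven card statements kernel-closed.
Further landed support for the crux (same `Theorems/CardyFlipRussoQuadrupoleSelectionRule*`):
FlipLocalisation p101935, FlipTelescope p103487, StarRefinement p103498, CyclicAverage p103302,
RobustBlockDecay p103354, PoissonTwist p103521, SubmultiplicativeRate p103545, ColourDual p103727.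
See `Lines/Sketch.md` (report + typing recommendation) and `Lines/SketchTypingDraft.lean`.

GENERATION 4 (continuation c2, 2026-08-17): section `R4` at the end of this file — registered
stubs R1 `hasDerivAt_integral_gaussian_dilate` (Gaussian dilation identity = the jitter leg's
annealed Russo formula without GMT), R2 `abs_integral_mul_coord_le` (coordinate influence),
R3a/b `crossing_flipGraph_sdiff_subset_arms` / `crossing_sdiff_flipGraph_subset_arms` (open arms
of a flip response); the bits-leg statements `PairRate θ`, `ArmBudget θ` and the sorry-free
reduction `bitsDraft_of_pairRate_armBudget : PairRate θ → ArmBudget θ →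
QuadrupoleSelectionRuleBitsDraft` (the kernel WITH A RATE on L5, consumed form).
-/

noncomputable section

namespace Summit.CriticalPhenomena.CardyFormulaZ2.Cruxes.QuadrupoleSelectionRule.IdeasR1K1

open MeasureTheory ProbabilityTheory
open Literature.Probability.LatticeModels Literature.Probability.Percolation
open Literature.Analysis.FunctionSpaces

/-! ### Card A — partial rotations (statements verbatim from the Sketch) -/

/-- Rotation by `60°` of a jitter vector. -/
def rot60 (v : ℝ × ℝ) : ℝ × ℝ :=
  (v.1 / 2 - Real.sqrt 3 / 2 * v.2, Real.sqrt 3 / 2 * v.1 + v.2 / 2)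

/-- Partial rotation of a jitter field `ξ : Site 2 → ℝ × ℝ`: the sites of `S` receive the rotated jitter of
their `hexRot k`-preimage, the other sites keep theirs. -/
def partialRot (k : ℕ) (S : Set (Site 2)) [DecidablePred (· ∈ S)] (ξ : Site 2 → ℝ × ℝ) :
    Site 2 → ℝ × ℝ :=
  fun w => if w ∈ S then rot60 (ξ ((TriHexagon.hexRot k).symm w)) else ξ w

/-- **Card A, first lemma (jitter-leg instance of the partial-rotation symmetry Φ).** -/
def PartialRotationInvariance : Prop :=
  ∀ (k : ℕ) (S : Set (Site 2)) [DecidablePred (· ∈ S)], (TriHexagon.hexRot k) '' S = S →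
    (Measure.infinitePi (fun _ : Site 2 => (gaussianReal 0 1).prod (gaussianReal 0 1))).map
        (partialRot k S)
      = Measure.infinitePi (fun _ : Site 2 => (gaussianReal 0 1).prod (gaussianReal 0 1))

/-- **Card A, geometric half.** -/
def PartialRotationGeometry : Prop :=
  ∀ (k : ℕ) (σ : ℝ) (v : Site 2) (ξ : ℝ × ℝ),
    triEmbed (TriHexagon.hexRot k v) + (σ : ℂ) * (((rot60 ξ).1 : ℂ) + ((rot60 ξ).2 : ℂ) * Complex.I)
      = triEmbed ![(k : ℤ), (k : ℤ)] + triZeta * (triEmbed v + (σ : ℂ) * ((ξ.1 : ℂ) + (ξ.2 : ℂ) * Complex.I) - triEmbed ![(k : ℤ), (k : ℤ)])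

/-- **Card A, Poisson-hub instance.** -/
def PoissonPartialRotationInvariance : Prop :=
  ∀ (P : Measure (PointConfig ℂ)) (z : ℂ) (r θ : ℝ) (Φ : PointConfig ℂ → PointConfig ℂ),
    IsPoissonPointProcess (volume : Measure ℂ) P → Measurable Φ →
    (∀ (c : PointConfig ℂ) (s : Set ℂ), MeasurableSet s →
      (Φ c).count s =
        c.count ((fun w : ℂ => if dist w z < r then z + Complex.exp ((θ : ℂ) * Complex.I) * (w - z) else w) ⁻¹' s)) →
    P.map Φ = P

/-! ### Card B — continuity method with a robust gap -/

/-- **Card B, first lemma (the continuity/bootstrap principle in the leg parameter).** -/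
def BootstrapPrinciple : Prop :=
  ∀ (u : ℝ → ℝ) (ε ε' η : ℝ), ContinuousOn u (Set.Icc 0 1) → 0 ≤ ε' → u 0 ≤ ε → ε + ε' < η →
    (∀ t ∈ Set.Icc (0 : ℝ) 1, (∀ s ∈ Set.Icc (0 : ℝ) t, u s < η) → ∀ s ∈ Set.Icc (0 : ℝ) t, u s ≤ ε + ε' * s) →
    ∀ t ∈ Set.Icc (0 : ℝ) 1, u t ≤ ε + ε' * t

/-- **Card B, second lemma (robustness of a block decay rate).** -/
def RobustBlockDecay : Prop :=
  ∀ (C q : ℝ) (L : ℕ) (a : ℕ → ℕ → ℝ), 0 ≤ C → (∀ m n, 0 ≤ a m n) →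
    (∀ m k n, m ≤ k → k ≤ n → a m n ≤ C * a m k * a k n) →
    (∀ k, a k (k + L) ≤ q) →
    ∀ n : ℕ, a 0 (n * L) ≤ a 0 0 * (C * q) ^ n

/-! ### Card C — the cocircularity form -/

/-- The Delaunay cocircularity form of four points of `ℂ`. -/
def cocirc (z : Fin 4 → ℂ) : ℝ :=
  Matrix.det (Matrix.of fun i j => (![(z i).re, (z i).im, Complex.normSq (z i), 1] : Fin 4 → ℝ) j)

/-- **Card C, first lemma.** -/
def CocircSimilarityCovariance : Prop :=
  ∀ (z : Fin 4 → ℂ) (a c : ℂ), cocirc (fun i => a * z i + c) = Complex.normSq a ^ 2 * cocirc z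

/-- **Card C, second lemma (the flip kernel is spin 2).** -/
def CocircStrainSpinTwo : Prop :=
  ∀ (z : Fin 4 → ℂ) (b : ℂ) (θ s : ℝ),
    cocirc (fun i => Complex.exp ((θ : ℂ) * Complex.I) * z i
        + (s : ℂ) * b * (starRingEnd ℂ) (Complex.exp ((θ : ℂ) * Complex.I) * z i))
      = cocirc (fun i => z i + (s : ℂ) * (b * Complex.exp (-(2 * (θ : ℂ)) * Complex.I)) * (starRingEnd ℂ) (z i))

/-! ### Registered stubs (def-free signatures; each lands as its own `--supports` helper file) -/

/-- Stub S1 (card A): the standard Gaussian jitter law `N(0,1) ⊗ N(0,1)` on `ℝ × ℝ` is invariant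
under every rotation of the plane. -/
theorem stub_gaussianJitter_map_rotate (θ : ℝ) :
    ((gaussianReal 0 1).prod (gaussianReal 0 1)).map
        (fun v : ℝ × ℝ => (Real.cos θ * v.1 - Real.sin θ * v.2, Real.sin θ * v.1 + Real.cos θ * v.2))
      = (gaussianReal 0 1).prod (gaussianReal 0 1) := Summit.CriticalPhenomena.CardyFormulaZ2.Theorems.gaussianJitter_map_rotate θ

/-- Stub S2 (card A): an i.i.d. product measure is invariant under "reindex by a bijection, then
apply a law-preserving map at every coordinate". -/
theorem stub_infinitePi_map_partialTransform {ι α : Type*} [MeasurableSpace α]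
    (μ : Measure α) [IsProbabilityMeasure μ] (e : ι ≃ ι) (f : ι → α → α)
    (hf : ∀ i, Measurable (f i)) (hμ : ∀ i, μ.map (f i) = μ) :
    (Measure.infinitePi (fun _ : ι => μ)).map (fun ξ i => f i (ξ (e.symm i)))
      = Measure.infinitePi (fun _ : ι => μ) := Summit.CriticalPhenomena.CardyFormulaZ2.Theorems.infinitePi_map_partialTransform μ e f hf hμ

/-- Stub S3 (card A): `hexRot k` is, in the equilateral embedding, the Euclidean rotation by `60°`
about `triEmbed (k,k)`, and `rot60` is multiplication by `ζ = e^{iπ/3}` on jitters. -/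
theorem stub_triEmbed_hexRot_jitter (k : ℕ) (σ : ℝ) (v : Site 2) (ξ : ℝ × ℝ) :
    triEmbed (TriHexagon.hexRot k v)
        + (σ : ℂ) * (((ξ.1 / 2 - Real.sqrt 3 / 2 * ξ.2 : ℝ) : ℂ)
            + ((Real.sqrt 3 / 2 * ξ.1 + ξ.2 / 2 : ℝ) : ℂ) * Complex.I)
      = triEmbed ![(k : ℤ), (k : ℤ)]
        + triZeta * (triEmbed v + (σ : ℂ) * ((ξ.1 : ℂ) + (ξ.2 : ℂ) * Complex.I)
          - triEmbed ![(k : ℤ), (k : ℤ)]) := Summit.CriticalPhenomena.CardyFormulaZ2.Theorems.triEmbed_hexRot_jitter k σ v ξ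

/-- Stub S4 (card A): Mapping Theorem for the piecewise rotation — a configuration map `Φ` whose
counts are the pull-back counts along "rotate inside `B(z,r)` by `θ`, fix the outside" sends a
Poisson process of Lebesgue intensity to a Poisson process of Lebesgue intensity. -/
theorem stub_isPoissonPointProcess_map_partialRotation
    (P : Measure (PointConfig ℂ)) (z : ℂ) (r θ : ℝ) (Φ : PointConfig ℂ → PointConfig ℂ)
    (hP : IsPoissonPointProcess (volume : Measure ℂ) P) (hΦ : Measurable Φ)
    (hcount : ∀ (c : PointConfig ℂ) (s : Set ℂ), MeasurableSet s →
      (Φ c).count s = c.count ((fun w : ℂ => if dist w z < r then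
        z + Complex.exp ((θ : ℂ) * Complex.I) * (w - z) else w) ⁻¹' s)) :
    IsPoissonPointProcess (volume : Measure ℂ) (P.map Φ) := Summit.CriticalPhenomena.CardyFormulaZ2.Theorems.isPoissonPointProcess_map_partialRotation P z r θ Φ hP hΦ hcount

/-- Stub S5 (card B): the continuity (bootstrap) principle on `[0,1]`. -/
theorem stub_bootstrap_principle (u : ℝ → ℝ) (ε ε' η : ℝ) (hu : ContinuousOn u (Set.Icc 0 1))
    (hε' : 0 ≤ ε') (h0 : u 0 ≤ ε) (hgap : ε + ε' < η)
    (hboot : ∀ t ∈ Set.Icc (0 : ℝ) 1, (∀ s ∈ Set.Icc (0 : ℝ) t, u s < η) →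
      ∀ s ∈ Set.Icc (0 : ℝ) t, u s ≤ ε + ε' * s) :
    ∀ t ∈ Set.Icc (0 : ℝ) 1, u t ≤ ε + ε' * t := Summit.CriticalPhenomena.CardyFormulaZ2.Theorems.bootstrap_principle u ε ε' η hu hε' h0 hgap hboot

/-- Stub S6 (card C): the cocircularity determinant is a relative invariant of weight `|a|⁴`
under the similarities `w ↦ a w + c`. -/
theorem stub_cocirc_det_similarity (z : Fin 4 → ℂ) (a c : ℂ) :
    Matrix.det (Matrix.of fun i j =>
        (![(a * z i + c).re, (a * z i + c).im, Complex.normSq (a * z i + c), 1] : Fin 4 → ℝ) j)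
      = Complex.normSq a ^ 2 * Matrix.det (Matrix.of fun i j =>
        (![(z i).re, (z i).im, Complex.normSq (z i), 1] : Fin 4 → ℝ) j) := Summit.CriticalPhenomena.CardyFormulaZ2.Theorems.cocirc_det_similarity z a c

/-- Stub S7 (card C): any similarity-covariant function of four points responds to a strain of a
rotated quadrilateral as to the spin-2-rotated strain of the original one. -/
theorem stub_spinTwo_of_similarity (D : (Fin 4 → ℂ) → ℝ)
    (hD : ∀ (z : Fin 4 → ℂ) (a c : ℂ), D (fun i => a * z i + c) = Complex.normSq a ^ 2 * D z)
    (z : Fin 4 → ℂ) (b : ℂ) (θ s : ℝ) :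
    D (fun i => Complex.exp ((θ : ℂ) * Complex.I) * z i
        + (s : ℂ) * b * (starRingEnd ℂ) (Complex.exp ((θ : ℂ) * Complex.I) * z i))
      = D (fun i => z i + (s : ℂ) * (b * Complex.exp (-(2 * (θ : ℂ)) * Complex.I))
        * (starRingEnd ℂ) (z i)) := Summit.CriticalPhenomena.CardyFormulaZ2.Theorems.spinTwo_of_similarity D hD z b θ s

/-! ### Glue: the card statements from the stubs -/

/-- `rot60` is the rotation by `π/3`. -/
theorem rot60_eq_rotate (v : ℝ × ℝ) :
    rot60 v = (Real.cos (Real.pi / 3) * v.1 - Real.sin (Real.pi / 3) * v.2,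
      Real.sin (Real.pi / 3) * v.1 + Real.cos (Real.pi / 3) * v.2) := by
  rw [Real.cos_pi_div_three, Real.sin_pi_div_three, rot60]
  ext <;> ring

/-- The jitter law is `rot60`-invariant (stub S1 at `θ = π/3`). -/
theorem gaussianJitter_map_rot60 :
    ((gaussianReal 0 1).prod (gaussianReal 0 1)).map rot60
      = (gaussianReal 0 1).prod (gaussianReal 0 1) := by
  have h : rot60 = fun v : ℝ × ℝ => (Real.cos (Real.pi / 3) * v.1 - Real.sin (Real.pi / 3) * v.2,
      Real.sin (Real.pi / 3) * v.1 + Real.cos (Real.pi / 3) * v.2) := funext rot60_eq_rotate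
  rw [h]
  exact stub_gaussianJitter_map_rotate _

/-- `rot60` is measurable. -/
theorem measurable_rot60 : Measurable rot60 := by
  unfold rot60
  fun_prop

/-- Card A, first lemma, from stubs S1–S2. -/
theorem partialRotationInvariance_holds : PartialRotationInvariance := by
  intro k S _ hS
  have hmem : ∀ w, TriHexagon.hexRot k w ∈ S ↔ w ∈ S := by
    intro w
    constructor
    · intro hw
      rw [← hS] at hw
      obtain ⟨w', hw', he⟩ := hw
      rwa [← (TriHexagon.hexRot k).injective he]
    · intro hw
      rw [← hS]
      exact ⟨w, hw, rfl⟩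
  have hmem' : ∀ w, (TriHexagon.hexRot k).symm w ∈ S ↔ w ∈ S := fun w => by
    rw [← hmem, Equiv.apply_symm_apply]
  let e : Site 2 ≃ Site 2 :=
    { toFun := fun w => if w ∈ S then TriHexagon.hexRot k w else w
      invFun := fun w => if w ∈ S then (TriHexagon.hexRot k).symm w else w
      left_inv := fun w => by
        by_cases hw : w ∈ S
        · simp [hw, (hmem w).2 hw]
        · simp [hw]
      right_inv := fun w => by
        by_cases hw : w ∈ S
        · simp [hw, (hmem' w).2 hw]
        · simp [hw] }
  let f : Site 2 → ℝ × ℝ → ℝ × ℝ := fun w => if w ∈ S then rot60 else id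
  have hpr : partialRot k S = fun ξ i => f i (ξ (e.symm i)) := by
    funext ξ i
    by_cases hi : i ∈ S
    · simp [partialRot, f, e, hi]
    · simp [partialRot, f, e, hi]
  rw [hpr]
  refine stub_infinitePi_map_partialTransform _ e f (fun i => ?_) (fun i => ?_)
  · by_cases hi : i ∈ S
    · simpa [f, hi] using measurable_rot60
    · simpa [f, hi] using measurable_id
  · by_cases hi : i ∈ S
    · simpa [f, hi] using gaussianJitter_map_rot60
    · simp [f, hi]

/-- Card A, geometric half, from stub S3. -/
theorem partialRotationGeometry_holds : PartialRotationGeometry :=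
  fun k σ v ξ => stub_triEmbed_hexRot_jitter k σ v ξ

/-- Card A, Poisson instance, from stub S4 and Rényi–Kingman uniqueness (`unique_holds`, proved
in `Literature/Analysis/FunctionSpaces/PoissonPointProcessUniqueness.lean`). -/
theorem poissonPartialRotationInvariance_holds : PoissonPartialRotationInvariance := by
  intro P z r θ Φ hP hΦ hcount
  exact (IsPoissonPointProcess.unique_holds hP
    (stub_isPoissonPointProcess_map_partialRotation P z r θ Φ hP hΦ hcount)).symm

/-- Card B, first lemma, from stub S5. -/
theorem bootstrapPrinciple_holds : BootstrapPrinciple :=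
  fun u ε ε' η hu hε' h0 hgap hboot => stub_bootstrap_principle u ε ε' η hu hε' h0 hgap hboot

/-- Card B, second lemma (chaining; proved in the Sketch). -/
theorem robustBlockDecay_holds : RobustBlockDecay := by
  intro C q L a hC ha hsub hq n
  induction n with
  | zero => simp
  | succ n ih =>
    have h1 : a 0 ((n + 1) * L) ≤ C * a 0 (n * L) * a (n * L) ((n + 1) * L) :=
      hsub 0 (n * L) ((n + 1) * L) (Nat.zero_le _) (by nlinarith)
    have h2 : a (n * L) ((n + 1) * L) ≤ q := by
      have := hq (n * L)
      simpa [Nat.succ_mul, Nat.add_comm] using this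
    have hq0 : 0 ≤ q := le_trans (ha _ _) (hq 0)
    calc a 0 ((n + 1) * L) ≤ C * a 0 (n * L) * a (n * L) ((n + 1) * L) := h1
      _ ≤ C * a 0 (n * L) * q := by
          apply mul_le_mul_of_nonneg_left h2
          exact mul_nonneg hC (ha _ _)
      _ ≤ C * (a 0 0 * (C * q) ^ n) * q := by
          apply mul_le_mul_of_nonneg_right _ hq0
          exact mul_le_mul_of_nonneg_left ih hC
      _ = a 0 0 * (C * q) ^ (n + 1) := by ring

/-- Card C, first lemma, from stub S6. -/
theorem cocircSimilarityCovariance_holds : CocircSimilarityCovariance :=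
  fun z a c => stub_cocirc_det_similarity z a c

/-- Card C, second lemma, from stub S7 applied to `cocirc`. -/
theorem cocircStrainSpinTwo_holds : CocircStrainSpinTwo :=
  fun z b θ s => stub_spinTwo_of_similarity cocirc cocircSimilarityCovariance_holds z b θ s

/-! ### Composition -/

/-- **Composition of the line `Sketch`.** All seven first lemmas of the three crux idea cards hold
(modulo the registered stubs).  The crux `QuadrupoleSelectionRule` itself is informal
(stmt-CriticalPhenomena-7029 has no Lean signature), so this conjunction is what the line
delivers. -/
theorem firstLemmas :
    PartialRotationInvariance ∧ PartialRotationGeometry ∧ PoissonPartialRotationInvariance ∧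
      BootstrapPrinciple ∧ RobustBlockDecay ∧ CocircSimilarityCovariance ∧ CocircStrainSpinTwo :=
  ⟨partialRotationInvariance_holds, partialRotationGeometry_holds,
    poissonPartialRotationInvariance_holds, bootstrapPrinciple_holds, robustBlockDecay_holds,
    cocircSimilarityCovariance_holds, cocircStrainSpinTwo_holds⟩

end Summit.CriticalPhenomena.CardyFormulaZ2.Cruxes.QuadrupoleSelectionRule.IdeasR1K1

/-! ## Generations 2–3 (continuation c1, 2026-08-16): the TRANSFER chain of card A (abstract stubs T1–T6) and its
concrete leg ends (G1–G4, bits / Poisson legs) — ALL LANDED; this section is sorry-free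
(lead's working copy `work/QuadrupoleSelectionRule.lean`). -/

/-!
# Line `Sketch`, generation 2 — the TRANSFER chain of card A, abstract form
(crux `QuadrupoleSelectionRule`, stmt-CriticalPhenomena-7029, route `CardyFlipRusso`,
sub-problem `CardyFormulaZ2`; lead prover, continuation c1)

The crux is INFORMAL (no `QuadrupoleSelectionRule` in `Theses/CardyFlipRusso.lean`, rev 4), so no
skeleton can conclude it by name.  Generation 1 of this line (`Lines/Sketch.lean`, closed) landed
the FIRST LEMMAS of the three crux idea cards.  Generation 2 drives the same line one level up:
the `Transfer` section of card A `average-first-odd-sector-gap` ("C⁺ ⟹ clause (iii), which is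
exactly what the legs consume"), written as DEF-FREE measure-theoretic / real-analytic stubs whose
composition is the leg-form statement recommended for typing the crux
(`Lines/SketchTypingDraft.lean`, `QuadrupoleSelectionRuleLegDraft`), for an ABSTRACT annealed
crossing probability `P σ δ`.

Dictionary (card A ↔ this file).  Landing (arrival) data `ϑ : Θ` of the four interfaces issued
from a quadrilateral face, read on a mesoscopic circle; `σ : Θ → Θ` the ROLE SHIFT of the four
slots (an involution once the two open slots and the two closed slots are read unordered, the
"either order" convention S4); `M` the annealed flip-weighted arrival measure of a disc; `g` the
partial rotation of the disc by `2π/m` (a symmetry of the leg LAW: `PartialRotationInvariance`,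
`PoissonPartialRotationInvariance`, gen 1), commuting with `σ`; `f` the far-field completion
functional, `f̄` its `C_m`-average.

* T1 `stub_slotShift` — slot-shift identity `Δ_Q = ⟨σ_*ν − ν, f⟩` (Fubini on inside ⊗ outside).
* T2 `stub_averageFirst` — `⟨σ_*M − M, f⟩ = ⟨σ_*M − M, f̄⟩` when `g_*M = M` and `gσ = σg`.
* T3 `stub_involution` — `⟨σ_*M − M, h⟩ = ½⟨σ_*M − M, h − h∘σ⟩` for an involution `σ`:
  the pairing is the product of an INNER smallness (`σ_*M − M` on `g`-invariant test functions)
  and an OUTER smallness (`sup |f̄ − f̄∘σ|`) — card A's `(δ/r)^{θ_in} · r^{θ_out}`.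
* T4 `stub_isoCancel` — isotropic cancellation in measure form: `∫ F dμ = 0` when `μ` is
  `g`-invariant and `F∘g = ω F`, `ω ≠ 1` (the spin `∉ mℤ` channels; gen 1 had the finite-sum form).
* T5 `stub_exponents` — bookkeeping: `|S δ| ≤ C (δ/δ^a)^{θ_in} (δ^a)^{θ_out} N δ`,
  `N δ ≤ C' δ^{-(θ*+ε)}`, `(1−a)θ_in + aθ_out > θ* + ε` ⟹ `S → 0` as `δ → 0⁺`.
* T6 `stub_legDraft_of_deriv_bound` — mean-value step: a `σ`-uniform bound `η δ → 0` on the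
  annealed Russo derivative gives the leg-form statement (uniform closeness along the leg).

Composition: `disc_pairing_bound` (T2 + T3: `|⟨σ_*M − M, f⟩| ≤ κ_in κ_out / 2`) is the disc-level
estimate; summed over the `δ^{-2a}` discs with quasi-multiplicativity (the percolation estimate of
C⁺, NOT provable now) it yields the hypothesis `hD` of `legDraft_of_transfer` (T5 + T6), whose
conclusion is `QuadrupoleSelectionRuleLegDraft` for the abstract `P`.  The annealed Russo formula
`hRusso` is landed for the product-of-bits leg (`hasDerivWithinAt_annealed_flipLeg`) and the
Poisson superposition leg (`poisson_perturbation_hasDerivWithinAt`).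
-/

open MeasureTheory Filter Topology Set

namespace Summit.CriticalPhenomena.CardyFormulaZ2.Cruxes.QuadrupoleSelectionRule.TransferR2

/-! ### Registered stubs (def-free; each LANDED as its own `--supports` helper file, 2026-08-16:
T1 SlotShift p114556 · T2 AverageFirst p112662 · T3 Involution p112923 · T4 IsoCancel p113667 ·
T5 Exponents p114092 · T6 LegMVT p113511 — files `Theorems/CardyFlipRussoQuadrupoleSelectionRule<X>.lean`) -/

/-- Stub T1 (slot-shift identity, abstract Fubini form).  Inside randomness `μ` and outside
randomness `ν` independent; the arc event is `{(x, y) | (ϑ x, y) ∈ A}` and its role-shifted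
version `{(x, y) | (σ (ϑ x), y) ∈ A}`; then the difference of their probabilities is the integral
of `f ∘ σ − f` against the arrival law `ϑ_* μ`, `f θ = ν {y | (θ, y) ∈ A}`. -/
theorem stub_slotShift {X Y Θ : Type*} [MeasurableSpace X] [MeasurableSpace Y]
    [MeasurableSpace Θ] (μ : Measure X) (ν : Measure Y) [IsProbabilityMeasure μ]
    [IsProbabilityMeasure ν] (ϑ : X → Θ) (hϑ : Measurable ϑ) (σ : Θ → Θ) (hσ : Measurable σ)
    (A : Set (Θ × Y)) (hA : MeasurableSet A) :
    (μ.prod ν).real {p | (σ (ϑ p.1), p.2) ∈ A} - (μ.prod ν).real {p | (ϑ p.1, p.2) ∈ A} =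
      ∫ θ, (ν.real {y | (σ θ, y) ∈ A} - ν.real {y | (θ, y) ∈ A}) ∂(μ.map ϑ) :=
  Summit.CriticalPhenomena.CardyFormulaZ2.Theorems.prod_real_shift_sub_eq_integral_map μ ν ϑ hϑ σ hσ A hA

/-- Stub T2 (average first).  If the arrival measure `M` is invariant under `g` and `g`
commutes with the role shift `σ`, the pairing of `σ_*M − M` with a bounded observable `f` equals
its pairing with the Cesàro average of `f` along the first `m + 1` iterates of `g`. -/
theorem stub_averageFirst {Θ : Type*} [MeasurableSpace Θ] (M : Measure Θ) [IsFiniteMeasure M]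
    (g σ : Θ → Θ) (hg : Measurable g) (hσ : Measurable σ) (hM : M.map g = M)
    (hcomm : ∀ θ, g (σ θ) = σ (g θ)) (f : Θ → ℝ) (hf : Measurable f) (hfb : ∃ C, ∀ θ, |f θ| ≤ C)
    (m : ℕ) :
    (∫ θ, f θ ∂(M.map σ)) - ∫ θ, f θ ∂M =
      (∫ θ, (∑ k ∈ Finset.range (m + 1), f (g^[k] θ)) / (m + 1 : ℝ) ∂(M.map σ)) -
        ∫ θ, (∑ k ∈ Finset.range (m + 1), f (g^[k] θ)) / (m + 1 : ℝ) ∂M :=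
  Summit.CriticalPhenomena.CardyFormulaZ2.Theorems.integral_map_sub_integral_eq_cesaro M g σ hg hσ hM hcomm f hf hfb m

/-- Stub T3 (involution identity).  For an involutive role shift `σ`, the pairing of
`σ_*M − M` with `h` is half its pairing with the `σ`-odd part `h − h ∘ σ`. -/
theorem stub_involution {Θ : Type*} [MeasurableSpace Θ] (M : Measure Θ) [IsFiniteMeasure M]
    (σ : Θ → Θ) (hσ : Measurable σ) (hinv : ∀ θ, σ (σ θ) = θ) (h : Θ → ℝ) (hh : Measurable h)
    (hhb : ∃ C, ∀ θ, |h θ| ≤ C) :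
    (∫ θ, h θ ∂(M.map σ)) - ∫ θ, h θ ∂M =
      (1 / 2 : ℝ) * ((∫ θ, (h θ - h (σ θ)) ∂(M.map σ)) - ∫ θ, (h θ - h (σ θ)) ∂M) :=
  Summit.CriticalPhenomena.CardyFormulaZ2.Theorems.integral_map_sub_integral_eq_half_odd M σ hσ hinv h hh hhb

/-- Stub T4 (isotropic cancellation, measure form).  A `g`-invariant law integrates every
observable of nontrivial `g`-weight `ω ≠ 1` to zero (spin `s ∉ mℤ` under a rotation of order `m`,
`ω = e^{2πis/m}`). -/
theorem stub_isoCancel {X : Type*} [MeasurableSpace X] (μ : Measure X) (g : X → X)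
    (hg : Measurable g) (hμ : μ.map g = μ) (F : X → ℂ) (hF : Measurable F) (ω : ℂ) (hω : ω ≠ 1)
    (hFg : ∀ x, F (g x) = ω * F x) :
    ∫ x, F x ∂μ = 0 :=
  Summit.CriticalPhenomena.CardyFormulaZ2.Theorems.integral_eq_zero_of_map_eq_of_comp_eq_mul μ g hg hμ F hF ω hω hFg

/-- Stub T5 (exponent bookkeeping of C⁺).  With matching scale `r = δ^a`, an inner rate `θ_in`,
an outer rate `θ_out`, the marginality exponent `θ*` of the flip-weighted pivotal count `N`, and the
gap `(1−a)θ_in + aθ_out > θ* + ε`, the bound `C (δ/r)^{θ_in} r^{θ_out} N δ` forces `S δ → 0`. -/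
theorem stub_exponents (S N : ℝ → ℝ) (C C' θin θout θstar ε a : ℝ) (ha0 : 0 ≤ a) (ha1 : a ≤ 1)
    (hC : 0 ≤ C) (hC' : 0 ≤ C') (hgap : θstar + ε < (1 - a) * θin + a * θout)
    (hN0 : ∀ δ, 0 < δ → δ < 1 → 0 ≤ N δ)
    (hN : ∀ δ, 0 < δ → δ < 1 → N δ ≤ C' * δ ^ (-(θstar + ε)))
    (hS : ∀ δ, 0 < δ → δ < 1 → |S δ| ≤ C * (δ / δ ^ a) ^ θin * (δ ^ a) ^ θout * N δ) :
    Tendsto S (𝓝[>] 0) (𝓝 0) :=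
  Summit.CriticalPhenomena.CardyFormulaZ2.Theorems.tendsto_zero_of_exponent_gap S N C C' θin θout θstar ε a ha0 ha1 hC hC' hgap hN0 hN hS

/-- Stub T6 (mean-value reduction to the leg form).  If along the leg `σ ↦ P σ δ` has a
derivative bounded by `η δ` uniformly on `[0, σ₀]`, and `η δ → 0` as `δ → 0⁺`, then the crossing
probabilities are uniformly close along the leg for small mesh. -/
theorem stub_legDraft_of_deriv_bound (P D : ℝ → ℝ → ℝ) (η : ℝ → ℝ) (σ₀ : ℝ) (hσ₀ : 0 < σ₀)
    (hderiv : ∀ δ, 0 < δ → δ < 1 → ∀ σ ∈ Icc (0 : ℝ) σ₀,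
      HasDerivWithinAt (fun s => P s δ) (D σ δ) (Icc (0 : ℝ) σ₀) σ)
    (hbound : ∀ δ, 0 < δ → δ < 1 → ∀ σ ∈ Icc (0 : ℝ) σ₀, |D σ δ| ≤ η δ)
    (hη : Tendsto η (𝓝[>] 0) (𝓝 0)) :
    ∀ ε : ℝ, 0 < ε → ∃ δ₀ : ℝ, 0 < δ₀ ∧ ∀ δ : ℝ, 0 < δ → δ < δ₀ →
      ∀ σ ∈ Icc (0 : ℝ) σ₀, ∀ σ' ∈ Icc (0 : ℝ) σ₀, |P σ δ - P σ' δ| ≤ ε :=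
  Summit.CriticalPhenomena.CardyFormulaZ2.Theorems.uniform_close_of_deriv_bound P D η σ₀ hσ₀ hderiv hbound hη

/-! ### Composition, disc level (card A: `S_z = ⟨σ_*M − M, f̄⟩`, inner × outer) -/

/-- The Cesàro average of `f` along the iterates of `g`. -/
theorem cesaro_abs_le {Θ : Type*} (g : Θ → Θ) (f : Θ → ℝ) (C : ℝ) (hC : ∀ θ, |f θ| ≤ C)
    (m : ℕ) (θ : Θ) :
    |(∑ k ∈ Finset.range (m + 1), f (g^[k] θ)) / (m + 1 : ℝ)| ≤ C := by
  have hm : (0 : ℝ) < (m + 1 : ℝ) := by positivity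
  rw [abs_div, abs_of_pos hm, div_le_iff₀ hm]
  calc |∑ k ∈ Finset.range (m + 1), f (g^[k] θ)|
      ≤ ∑ k ∈ Finset.range (m + 1), |f (g^[k] θ)| := Finset.abs_sum_le_sum_abs _ _
    _ ≤ ∑ _k ∈ Finset.range (m + 1), C := Finset.sum_le_sum fun k _ => hC _
    _ = C * (m + 1 : ℝ) := by simp [mul_comm]

/-- **Disc-level bound (T2 + T3).**  Let `M` be `g`-invariant with `g σ = σ g`, `σ` an
involution, `f` bounded measurable and `f̄` its Cesàro average along `g`.  If `σ_*M − M` is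
`κ_in`-small on test functions `h` that are bounded by `c` and satisfy the predicate `Inv`
(intended: `g`-invariance), if `f̄ − f̄∘σ` satisfies `Inv`, and if `|f̄ − f̄∘σ| ≤ κ_out`
pointwise, then `|⟨σ_*M − M, f⟩| ≤ κ_in κ_out / 2`. -/
theorem disc_pairing_bound {Θ : Type*} [MeasurableSpace Θ] (M : Measure Θ) [IsFiniteMeasure M]
    (g σ : Θ → Θ) (hg : Measurable g) (hσ : Measurable σ) (hM : M.map g = M)
    (hcomm : ∀ θ, g (σ θ) = σ (g θ)) (hinv : ∀ θ, σ (σ θ) = θ) (f : Θ → ℝ) (hf : Measurable f)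
    (C : ℝ) (hC : ∀ θ, |f θ| ≤ C) (m : ℕ) (Inv : (Θ → ℝ) → Prop) (κin κout : ℝ)
    (hκout : 0 ≤ κout)
    (hin : ∀ h : Θ → ℝ, Measurable h → Inv h → ∀ c : ℝ, 0 ≤ c → (∀ θ, |h θ| ≤ c) →
      |(∫ θ, h θ ∂(M.map σ)) - ∫ θ, h θ ∂M| ≤ κin * c)
    (hInv : Inv (fun θ => (∑ k ∈ Finset.range (m + 1), f (g^[k] θ)) / (m + 1 : ℝ) -
      (∑ k ∈ Finset.range (m + 1), f (g^[k] (σ θ))) / (m + 1 : ℝ)))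
    (hout : ∀ θ, |(∑ k ∈ Finset.range (m + 1), f (g^[k] θ)) / (m + 1 : ℝ) -
      (∑ k ∈ Finset.range (m + 1), f (g^[k] (σ θ))) / (m + 1 : ℝ)| ≤ κout) :
    |(∫ θ, f θ ∂(M.map σ)) - ∫ θ, f θ ∂M| ≤ κin * κout / 2 := by
  -- name the Cesàro average
  set fbar : Θ → ℝ := fun θ => (∑ k ∈ Finset.range (m + 1), f (g^[k] θ)) / (m + 1 : ℝ)
    with hfbar_def
  have hfbar_meas : Measurable fbar := by
    refine Measurable.div_const (Finset.measurable_sum _ fun k _ => ?_) _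
    exact hf.comp (hg.iterate k)
  have hfbar_bdd : ∀ θ, |fbar θ| ≤ C := fun θ => cesaro_abs_le g f C hC m θ
  -- T2: replace `f` by its average
  have h2 := stub_averageFirst M g σ hg hσ hM hcomm f hf ⟨C, hC⟩ m
  -- T3: involution identity for `fbar`
  have h3 := stub_involution M σ hσ hinv fbar hfbar_meas ⟨C, hfbar_bdd⟩
  -- the odd part of `fbar`
  have hodd_meas : Measurable fun θ => fbar θ - fbar (σ θ) :=
    hfbar_meas.sub (hfbar_meas.comp hσ)
  -- T2 then T3, then the inner bound on the odd part of `fbar`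
  have key : (∫ θ, f θ ∂(M.map σ)) - ∫ θ, f θ ∂M =
      (1 / 2 : ℝ) * ((∫ θ, (fbar θ - fbar (σ θ)) ∂(M.map σ)) - ∫ θ, (fbar θ - fbar (σ θ)) ∂M) :=
    h2.trans h3
  have hb := hin (fun θ => fbar θ - fbar (σ θ)) hodd_meas hInv κout hκout hout
  rw [key, abs_mul, abs_of_pos (by norm_num : (0 : ℝ) < 1 / 2)]
  nlinarith [hb, abs_nonneg ((∫ θ, (fbar θ - fbar (σ θ)) ∂(M.map σ)) - ∫ θ, (fbar θ - fbar (σ θ)) ∂M)]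

/-! ### Composition, leg level (T5 + T6 ⟹ the leg-form statement for an abstract `P`) -/

/-- **Transfer, leg level.**  Let `P σ δ` be the annealed crossing probability along a leg and
`D σ δ` its `σ`-derivative (annealed Russo formula, `hRusso`).  If the derivative is bounded by
the C⁺-shaped quantity `C (δ/δ^a)^{θ_in} (δ^a)^{θ_out} N δ` uniformly in `σ ∈ [0, σ₀]` (the
disc bounds `disc_pairing_bound` summed over discs with quasi-multiplicativity), the flip-weighted
pivotal count satisfies `N δ ≤ C' δ^{-(θ* + ε)}`, and the exponents have the gap
`(1 − a) θ_in + a θ_out > θ* + ε`, then the leg-form conclusion holds for `P`: for every `ε' > 0`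
there is `δ₀ > 0` with `|P σ δ − P σ' δ| ≤ ε'` for all `δ ∈ (0, δ₀)` and `σ, σ' ∈ [0, σ₀]`
(the shape of `QuadrupoleSelectionRuleLegDraft`, `Lines/SketchTypingDraft.lean`). -/
theorem legDraft_of_transfer (P D N : ℝ → ℝ → ℝ) (σ₀ C C' θin θout θstar ε a : ℝ)
    (hσ₀ : 0 < σ₀) (ha0 : 0 ≤ a) (ha1 : a ≤ 1) (hC : 0 ≤ C) (hC' : 0 ≤ C')
    (hgap : θstar + ε < (1 - a) * θin + a * θout)
    (hRusso : ∀ δ, 0 < δ → δ < 1 → ∀ σ ∈ Icc (0 : ℝ) σ₀,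
      HasDerivWithinAt (fun s => P s δ) (D σ δ) (Icc (0 : ℝ) σ₀) σ)
    (hN0 : ∀ δ, 0 < δ → δ < 1 → 0 ≤ N 0 δ)
    (hN : ∀ δ, 0 < δ → δ < 1 → N 0 δ ≤ C' * δ ^ (-(θstar + ε)))
    (hD : ∀ δ, 0 < δ → δ < 1 → ∀ σ ∈ Icc (0 : ℝ) σ₀,
      |D σ δ| ≤ C * (δ / δ ^ a) ^ θin * (δ ^ a) ^ θout * N 0 δ) :
    ∀ ε' : ℝ, 0 < ε' → ∃ δ₀ : ℝ, 0 < δ₀ ∧ ∀ δ : ℝ, 0 < δ → δ < δ₀ →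
      ∀ σ ∈ Icc (0 : ℝ) σ₀, ∀ σ' ∈ Icc (0 : ℝ) σ₀, |P σ δ - P σ' δ| ≤ ε' := by
  -- the uniform bound on the derivative
  set η : ℝ → ℝ := fun δ => C * (δ / δ ^ a) ^ θin * (δ ^ a) ^ θout * N 0 δ with hη_def
  have hη_nonneg : ∀ δ, 0 < δ → δ < 1 → 0 ≤ η δ := by
    intro δ hδ hδ1
    have h1 : 0 ≤ (δ / δ ^ a) ^ θin := Real.rpow_nonneg (div_nonneg hδ.le (Real.rpow_nonneg hδ.le _)) _
    have h2 : 0 ≤ (δ ^ a) ^ θout := Real.rpow_nonneg (Real.rpow_nonneg hδ.le _) _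
    exact mul_nonneg (mul_nonneg (mul_nonneg hC h1) h2) (hN0 δ hδ hδ1)
  -- T5: the bound tends to zero
  have hη : Tendsto η (𝓝[>] 0) (𝓝 0) := by
    refine stub_exponents η (N 0) C C' θin θout θstar ε a ha0 ha1 hC hC' hgap hN0 hN ?_
    intro δ hδ hδ1
    rw [abs_of_nonneg (hη_nonneg δ hδ hδ1)]
  -- T6: mean-value step
  exact stub_legDraft_of_deriv_bound P D η σ₀ hσ₀ hRusso (fun δ hδ hδ1 σ hσ => hD δ hδ hδ1 σ hσ) hη

/-! ### Generation 3 (same cycle): the CONCRETE ends of the transfer chain, per leg type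

* bits legs (L5; any product-of-bits environment): `uniform_close_annealed_flipLeg_of_kernel_bound`
  (landed, file `…BitsLegTransfer`): kernel bound `|Σ_{k ∈ K δ} E_t[Δ_k]| ≤ η δ → 0` ⟹ annealed
  crossing probabilities uniformly close along the leg (landed Russo `hasDerivWithinAt_annealed_flipLeg` + T6);
* inside/outside independence of the colours (G1, landed `sitePercolation_prod_map_glue`, file `…SiteGlue`):
  the hypothesis shape of T1 for site percolation;
* Poisson superposition legs (L2/L3): the perturbation formula at every `t₀` (G2, landed
  `hasDerivWithinAt_integral_union_poisson_at`, file `…PoissonPerturbationAt`), the one-sided mean-value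
  step (G3, landed `uniform_close_of_deriv_right_bound`, file `…LegMVTRight`), continuity in `t`
  (G4, landed `continuousOn_integral_union_poisson`, file `…PoissonLegContinuity`) and their composition `uniform_close_poissonLeg_of_kernel_bound`. -/

section PoissonLeg

open Literature.Analysis.FunctionSpaces

variable {E : Type*} [TopologicalSpace E] [T2Space E] [SecondCountableTopology E]
  [MeasurableSpace E] [BorelSpace E]

/-- Stub G4 (continuity along the superposition leg).  The annealed observable
`t ↦ ∫ F(c ∪ c') d(P ⊗ Q_t)` of a bounded measurable `F` is continuous on `[0, 1]`
(indeed Lipschitz: superposing `Q_s` changes the configuration only when `Q_s ≠ ∅`). -/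
theorem stub_continuousOn_integral_union_poisson
    (P : Measure (PointConfig E)) [IsFiniteMeasure P]
    (ρ : Measure E) [IsFiniteMeasure ρ]
    (Q : ℝ → Measure (PointConfig E))
    (hQ : ∀ t, 0 ≤ t → IsPoissonPointProcess ((ENNReal.ofReal t) • ρ) (Q t))
    (F : PointConfig E → ℝ) (hFm : Measurable F) (M : ℝ) (hFb : ∀ c, |F c| ≤ M) :
    ContinuousOn (fun t : ℝ => ∫ p, F (p.1 ∪ p.2) ∂(P.prod (Q t))) (Icc (0 : ℝ) 1) :=
  Summit.CriticalPhenomena.CardyFormulaZ2.Theorems.continuousOn_integral_union_poisson P ρ Q hQ F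
    hFm M hFb

/-- **Kernel bound ⟹ leg constancy (Poisson superposition leg), G2 + G3 + G4.**  Mesh-indexed
data: rest laws `P δ` (finite), bounded measurable observables `F δ` (e.g. the quenched crossing
probability of the Voronoi colouring at mesh `δ`), a finite atomless `ρ δ` and the Poisson family
`Q δ t` of intensity `t • ρ δ`.  If the annealed INSERTION EFFECT (the Russo derivative of G2) is
bounded by `η δ` uniformly in `t ∈ [0, 1)` with `η δ → 0`, the annealed observable is uniformly
close along the whole leg for small mesh. -/
theorem uniform_close_poissonLeg_of_kernel_bound
    (P : ℝ → Measure (PointConfig E)) [∀ δ, IsFiniteMeasure (P δ)]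
    (ρ : ℝ → Measure E) [∀ δ, IsFiniteMeasure (ρ δ)] (hρ : ∀ δ x, ρ δ {x} = 0)
    (Q : ℝ → ℝ → Measure (PointConfig E))
    (hQ : ∀ δ t, 0 ≤ t → IsPoissonPointProcess ((ENNReal.ofReal t) • ρ δ) (Q δ t))
    (F : ℝ → PointConfig E → ℝ) (hFm : ∀ δ, Measurable (F δ)) (M : ℝ → ℝ)
    (hFb : ∀ δ c, |F δ c| ≤ M δ) (η : ℝ → ℝ)
    (hkernel : ∀ δ, 0 < δ → δ < 1 → ∀ t ∈ Ico (0 : ℝ) 1,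
      |∫ x, ((∫ p, F δ (p.1 ∪ p.2 ∪ PointConfig.ofFn ![x]) ∂((P δ).prod (Q δ t))) -
          ∫ p, F δ (p.1 ∪ p.2) ∂((P δ).prod (Q δ t))) ∂(ρ δ)| ≤ η δ)
    (hη : Tendsto η (𝓝[>] 0) (𝓝 0)) :
    ∀ ε : ℝ, 0 < ε → ∃ δ₀ : ℝ, 0 < δ₀ ∧ ∀ δ : ℝ, 0 < δ → δ < δ₀ →
      ∀ t ∈ Icc (0 : ℝ) 1, ∀ t' ∈ Icc (0 : ℝ) 1,
        |(∫ p, F δ (p.1 ∪ p.2) ∂((P δ).prod (Q δ t))) -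
          ∫ p, F δ (p.1 ∪ p.2) ∂((P δ).prod (Q δ t'))| ≤ ε := by
  set Pf : ℝ → ℝ → ℝ := fun t δ => ∫ p, F δ (p.1 ∪ p.2) ∂((P δ).prod (Q δ t)) with hPf
  set Dr : ℝ → ℝ → ℝ := fun t δ =>
    ∫ x, ((∫ p, F δ (p.1 ∪ p.2 ∪ PointConfig.ofFn ![x]) ∂((P δ).prod (Q δ t))) -
      ∫ p, F δ (p.1 ∪ p.2) ∂((P δ).prod (Q δ t))) ∂(ρ δ) with hDr
  have hcont : ∀ δ, 0 < δ → δ < 1 → ContinuousOn (fun s => Pf s δ) (Icc (0 : ℝ) 1) :=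
    fun δ _ _ => stub_continuousOn_integral_union_poisson (P δ) (ρ δ) (Q δ) (hQ δ) (F δ)
      (hFm δ) (M δ) (hFb δ)
  have hderiv : ∀ δ, 0 < δ → δ < 1 → ∀ σ ∈ Ico (0 : ℝ) 1,
      HasDerivWithinAt (fun s => Pf s δ) (Dr σ δ) (Ici σ) σ :=
    fun δ _ _ σ hσ => Summit.CriticalPhenomena.CardyFormulaZ2.Theorems.hasDerivWithinAt_integral_union_poisson_at (P δ) (ρ δ) (hρ δ) (Q δ)
      (hQ δ) (F δ) (hFm δ) (M δ) (hFb δ) σ hσ.1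
  exact Summit.CriticalPhenomena.CardyFormulaZ2.Theorems.uniform_close_of_deriv_right_bound Pf Dr η 1 one_pos hcont hderiv hkernel hη

end PoissonLeg

end Summit.CriticalPhenomena.CardyFormulaZ2.Cruxes.QuadrupoleSelectionRule.TransferR2

end

noncomputable section

/-!
# Line `Sketch`, generation 4 (continuation c2, 2026-08-17): the kernel WITH A RATE on the bits
# leg L5, the Gaussian-jitter Russo formula without GMT, open-arm localisation — ALL LANDED

Section `R4` of the lead's skeleton (crux `QuadrupoleSelectionRule`, stmt-CriticalPhenomena-7029 —
still INFORMAL, so nothing here can conclude it by name).  Every registered stub of this generation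
is a LANDED theorem of the tree (imported above); this section is sorry-free.

* R1 `hasDerivAt_integral_gaussian_dilate` (…GaussianDilation.lean, p137119) — Gaussian dilation
  (score) identity `d/dσ E[F(σξ)] = σ⁻¹ E[F(σξ)(|ξ|² − n)]` for a bounded measurable `F` of
  finitely many standard Gaussian coordinates: the annealed Russo FORMULA of the jitter leg L1
  (`JitteredTriangularLeg`, `VoronoiHubFromSmirnov`) with no coarea formula and no flip rates —
  generation 3 had declared this step "out of reach (GMT absent from Mathlib)".
* R2 `abs_integral_mul_coord_le` (…CoordinateInfluence.lean, p137688) — coordinate-influence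
  bound; with R1 the annealed Russo INEQUALITY of the jitter leg
  `abs_jitterDeriv_le_sum_influence` (…JitterRusso.lean, p138432):
  `|d/dσ E F(σξ)| ≤ 2σ⁻¹‖F‖∞ Σ_v P[site v geometrically pivotal]`.
* R3a/R3b `crossing_flipGraph_sdiff_subset_arms`, `crossing_sdiff_flipGraph_subset_arms`
  (…FlipArms.lean, p138047) — the open-arm half of the four-arm localisation of a flip response,
  hypothesis-free, arms in `G ∖ AC` (the closed arms need planar duality).
* L5, over the DEFINITIONS MODULE `…QuadrupoleSelectionRuleDefs.lean` (p136184, namespace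
  `…Theorems.BitsLeg`: `Gamma τ`, `faces`, `GammaMesh`, `crossingEvent`, `legLaw`, `legProb`,
  `faceResponse`, `flipSum`, `armWeight`, `depth`, `cutoff`, `QuadrupoleSelectionRuleBits`,
  `PairRate θ`, `ArmBudget θ`): the REDUCTION `bits_of_pairRate_armBudget : PairRate θ →
  ArmBudget θ → QuadrupoleSelectionRuleBits` and the CONSUMPTION `legProb_uniform_close_of_bits`
  (…BitsReduction.lean, p138205); cycle 2: endpoint identification `Gamma univ = Gs`,
  `legProb R 1 δ = siteCrossingProb R δ` (…Endpoint.lean, p139496), monotonicity in `θ`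
  (…Monotone.lean, p139725), `ArmBudget 1 ⟸ BulkArm ε ∧ LayerArm` (…BulkLayer.lean, p139989), and
  L5 END TO END `gsCardy_of_pairRate_bulkArm_layerArm` (…GsTransfer.lean, p140123): the three
  named statements transfer Cardy's formula from the annealed fair-diagonal model (`t = ½`) to site
  percolation on `G_s` (`t = 1`, the route's `Target (ii)`).

TYPING RECOMMENDATION no. 3 (refines nos. 1–2, `Lines/Sketch.md`): type the kernel crux on L5 as
`Summit.CriticalPhenomena.CardyFormulaZ2.Theorems.BitsLeg.PairRate 1` (the selection rule proper,
normalisation-free, MC-testable; expected true rate ≈ 1.75 = 3 − 5/4, margin 3/4), with the support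
item `…BitsLeg.ArmBudget 1` (annealed RSW for the C₄-symmetric leg law — Köhler-Schindler–Tassion
2023 — plus the RSW-only bound `α₄ ≥ 1 + α₂/2` of van den Berg–Nolin 2021 for the bulk, plus
boundary layers); the glue to the leg is LANDED (`bits_of_pairRate_armBudget 1`,
`legProb_uniform_close_of_bits`).
-/

open MeasureTheory ProbabilityTheory Filter Topology Set
open scoped BigOperators

namespace Summit.CriticalPhenomena.CardyFormulaZ2.Cruxes.QuadrupoleSelectionRule.R4

open Literature.Probability.LatticeModels Literature.Probability.Percolation
  Literature.Probability.RandomPlanarGeometry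
open Summit.CriticalPhenomena.CardyFormulaZ2.Theorems

/-! ### Registered stubs (closed signatures as registered on the item; all LANDED) -/

/-- Stub R1 (Gaussian dilation / score identity) — LANDED p137119. -/
theorem stub_hasDerivAt_integral_gaussian_dilate :
    ∀ (ι : Type*) [Fintype ι] (F : (ι → ℝ) → ℝ), Measurable F → ∀ C : ℝ, (∀ x, |F x| ≤ C) → ∀ σ : ℝ, 0 < σ → HasDerivAt (fun s : ℝ => ∫ x, F (s • x) ∂(MeasureTheory.Measure.pi fun _ : ι => ProbabilityTheory.gaussianReal 0 1)) (σ⁻¹ * ∫ x, F (σ • x) * (∑ i, x i ^ 2 - (Fintype.card ι : ℝ)) ∂(MeasureTheory.Measure.pi fun _ : ι => ProbabilityTheory.gaussianReal 0 1)) σ :=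
  hasDerivAt_integral_gaussian_dilate

/-- Stub R2 (coordinate-influence bound) — LANDED p137688. -/
theorem stub_abs_integral_mul_coord_le :
    ∀ (ι : Type*) [Fintype ι] [DecidableEq ι] (μ : ι → MeasureTheory.Measure ℝ) [∀ i, MeasureTheory.IsProbabilityMeasure (μ i)] (i : ι) (F : (ι → ℝ) → ℝ), Measurable F → ∀ C : ℝ, (∀ x, |F x| ≤ C) → ∀ h : ℝ → ℝ, MeasureTheory.Integrable h (μ i) → ∫ t, h t ∂(μ i) = 0 → ∀ N : Set (ι → ℝ), MeasurableSet N → (∀ (x : ι → ℝ) (t : ℝ), x ∈ N ↔ Function.update x i t ∈ N) → (∀ x ∉ N, ∀ t : ℝ, F (Function.update x i t) = F x) → |∫ x, F x * h (x i) ∂(MeasureTheory.Measure.pi μ)| ≤ C * (∫ t, |h t| ∂(μ i)) * (MeasureTheory.Measure.pi μ).real N :=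
  abs_integral_mul_coord_le

/-- Stub R3a (open arms of what a flip creates) — LANDED p138047. -/
theorem stub_crossing_flipGraph_sdiff_subset_arms :
    ∀ (W : Type*) (G : SimpleGraph W) (A B C D : W) (S X Y : Set W), {ω : Literature.Probability.Percolation.SiteConfig W | ∃ u ∈ X, ∃ v ∈ Y, ω ∈ Literature.Probability.Percolation.siteConnIn (Literature.Probability.Percolation.flipGraph G A B C D) S u v} \ {ω | ∃ u ∈ X, ∃ v ∈ Y, ω ∈ Literature.Probability.Percolation.siteConnIn G S u v} ⊆ {ω | ((∃ u ∈ X, ω ∈ Literature.Probability.Percolation.siteConnIn (G.deleteEdges {s(A, C)}) S u B) ∧ (∃ v ∈ Y, ω ∈ Literature.Probability.Percolation.siteConnIn (G.deleteEdges {s(A, C)}) S D v)) ∨ ((∃ u ∈ X, ω ∈ Literature.Probability.Percolation.siteConnIn (G.deleteEdges {s(A, C)}) S u D) ∧ (∃ v ∈ Y, ω ∈ Literature.Probability.Percolation.siteConnIn (G.deleteEdges {s(A, C)}) S B v))} :=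
  crossing_flipGraph_sdiff_subset_arms

/-- Stub R3b (open arms of what a flip destroys) — LANDED p138047. -/
theorem stub_crossing_sdiff_flipGraph_subset_arms :
    ∀ (W : Type*) (G : SimpleGraph W) (A B C D : W) (S X Y : Set W), {ω : Literature.Probability.Percolation.SiteConfig W | ∃ u ∈ X, ∃ v ∈ Y, ω ∈ Literature.Probability.Percolation.siteConnIn G S u v} \ {ω | ∃ u ∈ X, ∃ v ∈ Y, ω ∈ Literature.Probability.Percolation.siteConnIn (Literature.Probability.Percolation.flipGraph G A B C D) S u v} ⊆ {ω | ((∃ u ∈ X, ω ∈ Literature.Probability.Percolation.siteConnIn (G.deleteEdges {s(A, C)}) S u A) ∧ (∃ v ∈ Y, ω ∈ Literature.Probability.Percolation.siteConnIn (G.deleteEdges {s(A, C)}) S C v)) ∨ ((∃ u ∈ X, ω ∈ Literature.Probability.Percolation.siteConnIn (G.deleteEdges {s(A, C)}) S u C) ∧ (∃ v ∈ Y, ω ∈ Literature.Probability.Percolation.siteConnIn (G.deleteEdges {s(A, C)}) S A v))} :=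
  crossing_sdiff_flipGraph_subset_arms

/-- Stub JR (annealed Russo inequality of the jitter leg; composition of R1 + R2) — LANDED p138432. -/
theorem stub_abs_jitterDeriv_le_sum_influence :
    ∀ (ι : Type*) [Fintype ι] [DecidableEq ι] (F : (ι → ℝ) → ℝ), Measurable F → ∀ C : ℝ, (∀ x, |F x| ≤ C) → ∀ σ : ℝ, 0 < σ → ∀ N : ι → Set (ι → ℝ), (∀ i, MeasurableSet (N i)) → (∀ (i : ι) (x : ι → ℝ) (t : ℝ), x ∈ N i ↔ Function.update x i t ∈ N i) → (∀ i, ∀ x ∉ N i, ∀ t : ℝ, F (σ • Function.update x i t) = F (σ • x)) → |σ⁻¹ * ∫ x, F (σ • x) * (∑ i, x i ^ 2 - (Fintype.card ι : ℝ)) ∂(MeasureTheory.Measure.pi fun _ : ι => ProbabilityTheory.gaussianReal 0 1)| ≤ σ⁻¹ * (2 * C) * ∑ i, (MeasureTheory.Measure.pi fun _ : ι => ProbabilityTheory.gaussianReal 0 1).real (N i) :=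
  abs_jitterDeriv_le_sum_influence

/-- Stub Red1 (the REDUCTION on L5: kernel with a rate) — LANDED p138205. -/
theorem stub_bits_of_pairRate_armBudget :
    ∀ θ : ℝ, Summit.CriticalPhenomena.CardyFormulaZ2.Theorems.BitsLeg.PairRate θ → Summit.CriticalPhenomena.CardyFormulaZ2.Theorems.BitsLeg.ArmBudget θ → Summit.CriticalPhenomena.CardyFormulaZ2.Theorems.BitsLeg.QuadrupoleSelectionRuleBits :=
  BitsLeg.bits_of_pairRate_armBudget

/-- Stub Red2 (the CONSUMPTION on L5) — LANDED p138205. -/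
theorem stub_legProb_uniform_close_of_bits :
    Summit.CriticalPhenomena.CardyFormulaZ2.Theorems.BitsLeg.QuadrupoleSelectionRuleBits → ∀ R : Literature.Probability.RandomPlanarGeometry.ConformalRectangle, ∀ ε : ℝ, 0 < ε → ∃ δ₀ : ℝ, 0 < δ₀ ∧ ∀ δ : ℝ, 0 < δ → δ < δ₀ → ∀ t ∈ Set.Icc (0 : ℝ) 1, ∀ t' ∈ Set.Icc (0 : ℝ) 1, |Summit.CriticalPhenomena.CardyFormulaZ2.Theorems.BitsLeg.legProb R t δ - Summit.CriticalPhenomena.CardyFormulaZ2.Theorems.BitsLeg.legProb R t' δ| ≤ ε :=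
  BitsLeg.legProb_uniform_close_of_bits

/-! ### Compositions -/

/-- **The jitter leg's annealed Russo calculus (L1), end to end**: the derivative of the annealed
expectation along the Gaussian-jitter leg EXISTS, is given by the dilation identity, and is bounded
by the sum of the coordinate influences (R1 + JR).  What the kernel must then supply on L1 is the
CANCELLATION in the signed sum `Σ_i Cov(F(σξ), ξ_i²)` (a-priori `≍ δ^{-3/4}`). -/
theorem jitterLeg_russo {ι : Type*} [Fintype ι] [DecidableEq ι] (F : (ι → ℝ) → ℝ)
    (hF : Measurable F) (C : ℝ) (hC : ∀ x, |F x| ≤ C) {σ : ℝ} (hσ : 0 < σ)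
    (N : ι → Set (ι → ℝ)) (hN : ∀ i, MeasurableSet (N i))
    (hNi : ∀ (i : ι) (x : ι → ℝ) (t : ℝ), x ∈ N i ↔ Function.update x i t ∈ N i)
    (hdep : ∀ i, ∀ x ∉ N i, ∀ t : ℝ, F (σ • Function.update x i t) = F (σ • x)) :
    HasDerivAt (fun s : ℝ => ∫ x, F (s • x) ∂(Measure.pi fun _ : ι => gaussianReal 0 1))
        (σ⁻¹ * ∫ x, F (σ • x) * (∑ i, x i ^ 2 - (Fintype.card ι : ℝ))
          ∂(Measure.pi fun _ : ι => gaussianReal 0 1)) σ ∧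
      |σ⁻¹ * ∫ x, F (σ • x) * (∑ i, x i ^ 2 - (Fintype.card ι : ℝ))
          ∂(Measure.pi fun _ : ι => gaussianReal 0 1)| ≤
        σ⁻¹ * (2 * C) * ∑ i, (Measure.pi fun _ : ι => gaussianReal 0 1).real (N i) :=
  ⟨stub_hasDerivAt_integral_gaussian_dilate ι F hF C hC σ hσ,
    stub_abs_jitterDeriv_le_sum_influence ι F hF C hC σ hσ N hN hNi hdep⟩

/-- **The bits leg (L5), end to end**: `PairRate θ ∧ ArmBudget θ` ⟹ the annealed crude crossing
probabilities of every conformal rectangle are uniformly close along the whole leg `t ∈ [0,1]` for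
small mesh (Red1 + Red2).  With Cardy's formula at `t = ½` this is Cardy's formula at `t = 1`
(`G_s`, the route's `Target (ii)`) by an `ε/2` argument. -/
theorem bitsLeg_uniform_close {θ : ℝ} (hP : BitsLeg.PairRate θ) (hA : BitsLeg.ArmBudget θ)
    (R : ConformalRectangle) :
    ∀ ε : ℝ, 0 < ε → ∃ δ₀ : ℝ, 0 < δ₀ ∧ ∀ δ : ℝ, 0 < δ → δ < δ₀ →
      ∀ t ∈ Icc (0 : ℝ) 1, ∀ t' ∈ Icc (0 : ℝ) 1,
        |BitsLeg.legProb R t δ - BitsLeg.legProb R t' δ| ≤ ε :=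
  stub_legProb_uniform_close_of_bits (stub_bits_of_pairRate_armBudget θ hP hA) R

/-- **Open-arm localisation of the flip response (R3a + R3b with the landed colour lemma)**: for a
flippable quadrilateral in the domain, what the flip creates is contained in the four-arm-type
event "`B, D` open with open arms to the two targets in `G ∖ AC`, `A, C` closed", and what it
destroys in "`A, C` open with open arms, `B, D` closed". -/
theorem flip_sdiff_subset_colours_and_arms {W : Type*} {G : SimpleGraph W} {A B C D : W}
    {S : Set W} (h : IsFlippableQuad G A B C D) (X Y : Set W) (hAS : A ∈ S) (hBS : B ∈ S)
    (hCS : C ∈ S) (hDS : D ∈ S) :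
    ({ω : SiteConfig W | ∃ u ∈ X, ∃ v ∈ Y, ω ∈ siteConnIn (flipGraph G A B C D) S u v} \
        {ω | ∃ u ∈ X, ∃ v ∈ Y, ω ∈ siteConnIn G S u v}
      ⊆ {ω | B ∈ ω ∧ D ∈ ω ∧ A ∉ ω ∧ C ∉ ω} ∩
        {ω | ((∃ u ∈ X, ω ∈ siteConnIn (G.deleteEdges {s(A, C)}) S u B) ∧
              (∃ v ∈ Y, ω ∈ siteConnIn (G.deleteEdges {s(A, C)}) S D v)) ∨
            ((∃ u ∈ X, ω ∈ siteConnIn (G.deleteEdges {s(A, C)}) S u D) ∧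
              (∃ v ∈ Y, ω ∈ siteConnIn (G.deleteEdges {s(A, C)}) S B v))}) ∧
    ({ω : SiteConfig W | ∃ u ∈ X, ∃ v ∈ Y, ω ∈ siteConnIn G S u v} \
        {ω | ∃ u ∈ X, ∃ v ∈ Y, ω ∈ siteConnIn (flipGraph G A B C D) S u v}
      ⊆ {ω | A ∈ ω ∧ C ∈ ω ∧ B ∉ ω ∧ D ∉ ω} ∩
        {ω | ((∃ u ∈ X, ω ∈ siteConnIn (G.deleteEdges {s(A, C)}) S u A) ∧
              (∃ v ∈ Y, ω ∈ siteConnIn (G.deleteEdges {s(A, C)}) S C v)) ∨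
            ((∃ u ∈ X, ω ∈ siteConnIn (G.deleteEdges {s(A, C)}) S u C) ∧
              (∃ v ∈ Y, ω ∈ siteConnIn (G.deleteEdges {s(A, C)}) S A v))}) := by
  obtain ⟨h1, h2⟩ :=
    Summit.CriticalPhenomena.CardyFormulaZ2.Theorems.IsFlippableQuad.crossing_symmDiff_subset h X Y hAS
      hBS hCS hDS
  exact ⟨Set.subset_inter h1 (stub_crossing_flipGraph_sdiff_subset_arms W G A B C D S X Y),
    Set.subset_inter h2 (stub_crossing_sdiff_flipGraph_subset_arms W G A B C D S X Y)⟩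


/-! ### Cycle 2 (same generation): endpoint, monotonicity, the arm budget split, L5 end to end — ALL LANDED -/

/-- Stub W1a (the endpoint graph IS `G_s`) — LANDED p139496. -/
theorem stub_Gamma_univ_eq_Gs :
    Summit.CriticalPhenomena.CardyFormulaZ2.Theorems.BitsLeg.Gamma Set.univ = Summit.CriticalPhenomena.CardyFormulaZ2.Cruxes.SquareFromVoronoiHub.VoronoiBlocks.Gs :=
  BitsLeg.Gamma_univ_eq_Gs

/-- Stub W1b (the endpoint probability IS `siteCrossingProb`) — LANDED p139496. -/
theorem stub_legProb_one_eq_siteCrossingProb :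
    ∀ (R : Literature.Probability.RandomPlanarGeometry.ConformalRectangle) (δ : ℝ), 0 < δ → Summit.CriticalPhenomena.CardyFormulaZ2.Theorems.BitsLeg.legProb R 1 δ = Summit.CriticalPhenomena.CardyFormulaZ2.Cruxes.SquareFromVoronoiHub.VoronoiBlocks.siteCrossingProb R δ :=
  BitsLeg.legProb_one_eq_siteCrossingProb

/-- Stub W2a (PairRate is antitone in θ) — LANDED p139725. -/
theorem stub_pairRate_anti :
    ∀ θ θ' : ℝ, θ' ≤ θ → Summit.CriticalPhenomena.CardyFormulaZ2.Theorems.BitsLeg.PairRate θ → Summit.CriticalPhenomena.CardyFormulaZ2.Theorems.BitsLeg.PairRate θ' :=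
  BitsLeg.pairRate_anti

/-- Stub W2b (ArmBudget is monotone in θ) — LANDED p139725. -/
theorem stub_armBudget_mono :
    ∀ θ θ' : ℝ, θ ≤ θ' → Summit.CriticalPhenomena.CardyFormulaZ2.Theorems.BitsLeg.ArmBudget θ → Summit.CriticalPhenomena.CardyFormulaZ2.Theorems.BitsLeg.ArmBudget θ' :=
  BitsLeg.armBudget_mono

/-- Stub W2c (any PairRate θ₁ with ArmBudget θ₂, θ₂ ≤ θ₁, gives the kernel) — LANDED p139725. -/
theorem stub_bits_of_pairRate_armBudget_of_le :
    ∀ θ₁ θ₂ : ℝ, θ₂ ≤ θ₁ → Summit.CriticalPhenomena.CardyFormulaZ2.Theorems.BitsLeg.PairRate θ₁ → Summit.CriticalPhenomena.CardyFormulaZ2.Theorems.BitsLeg.ArmBudget θ₂ → Summit.CriticalPhenomena.CardyFormulaZ2.Theorems.BitsLeg.QuadrupoleSelectionRuleBits :=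
  BitsLeg.bits_of_pairRate_armBudget_of_le

/-- Stub W3 (ArmBudget 1 from BulkArm ε + LayerArm) — LANDED p139989. -/
theorem stub_armBudget_one_of_bulkArm_layerArm :
    ∀ ε : ℝ, 0 < ε → Summit.CriticalPhenomena.CardyFormulaZ2.Theorems.BitsLeg.BulkArm ε → Summit.CriticalPhenomena.CardyFormulaZ2.Theorems.BitsLeg.LayerArm → Summit.CriticalPhenomena.CardyFormulaZ2.Theorems.BitsLeg.ArmBudget 1 :=
  BitsLeg.armBudget_one_of_bulkArm_layerArm

/-- Stub Gs (L5 END TO END) — LANDED p140123. -/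
theorem stub_gsCardy_of_pairRate_bulkArm_layerArm :
    ∀ ε : ℝ, 0 < ε → Summit.CriticalPhenomena.CardyFormulaZ2.Theorems.BitsLeg.PairRate 1 → Summit.CriticalPhenomena.CardyFormulaZ2.Theorems.BitsLeg.BulkArm ε → Summit.CriticalPhenomena.CardyFormulaZ2.Theorems.BitsLeg.LayerArm → ∀ R : Literature.Probability.RandomPlanarGeometry.ConformalRectangle, R.HasCrossingLimit (fun δ : ℝ => Summit.CriticalPhenomena.CardyFormulaZ2.Theorems.BitsLeg.legProb R (1 / 2) δ) Literature.Probability.RandomPlanarGeometry.cardyFunction → R.HasCrossingLimit (Summit.CriticalPhenomena.CardyFormulaZ2.Cruxes.SquareFromVoronoiHub.VoronoiBlocks.siteCrossingProb R) Literature.Probability.RandomPlanarGeometry.cardyFunction :=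
  BitsLeg.gsCardy_of_pairRate_bulkArm_layerArm

/-- **Leg L5 of `SquareFromVoronoiHub`, formal modulo three named statements.**  The selection
rule on the bits leg (`PairRate 1`), the bulk four-arm bound (`BulkArm ε`) and the boundary-layer
bound (`LayerArm`) transfer Cardy's formula from the annealed fair-diagonal model (rotated square
grid with one independent fair Delaunay diagonal per face, fair colours) to site percolation at `½`
on the centred square lattice `G_s` — the second conjunct of the route's `Target`. -/
theorem legL5_of_kernel {ε : ℝ} (hε : 0 < ε) (hP : BitsLeg.PairRate 1) (hB : BitsLeg.BulkArm ε)
    (hL : BitsLeg.LayerArm) (R : ConformalRectangle)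
    (hhalf : R.HasCrossingLimit (fun δ : ℝ => BitsLeg.legProb R (1 / 2) δ) cardyFunction) :
    R.HasCrossingLimit
      (Summit.CriticalPhenomena.CardyFormulaZ2.Cruxes.SquareFromVoronoiHub.VoronoiBlocks.siteCrossingProb R)
      cardyFunction :=
  stub_gsCardy_of_pairRate_bulkArm_layerArm ε hε hP hB hL R hhalf

end Summit.CriticalPhenomena.CardyFormulaZ2.Cruxes.QuadrupoleSelectionRule.R4

end
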